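import Literature.AnabelianGeometry.SemiGraphs.QuasiTemperoidsQDPairs
import HarnessLib

/-!
# Semi-graphs of anabelioids, Appendix: QD-pairs — Definition A.3 (iv) bracket (proof)

Mochizuki, *Semi-graphs of anabelioids*, Publ. RIMS **42** (2006) 221–322, Appendix
"Quasi-temperoids", Definition A.3 (iii)/(iv) and Remark A.3.1, manuscript p. 82
[cite: MochizukiSemiAnbd2006, Def A.3 p.82]. Proof-only companion of `QuasiTemperoidsQDPairs.lean`
(abc-iut-L3-t2): NO definitions; the named fact `QDPair.OneProperCompQuotient` is DISCHARGED as
stated (sub-DAG SemiAnbd:Cor3.11 row A3iv-br). The other Def. A.3 / Rmk A.3.1 brackets are the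
companions `QuasiTemperoidsRmkA31Model/Proofs.lean` and `QuasiTemperoidsQuotientConnectedProofs.lean`.

* `QDPair.oneProperCompQuotient_holds` — Definition A.3 (iv), bracket: "under the 1-properness
  assumption, one verifies immediately that if `B → C` forms a quotient of `(B, Γ_B)`, then the
  composite arrow `A → B → C` forms a quotient of `(A, Γ_A)`". The proof is purely formal (it uses
  only the surjectivity clause `Γ_A ↠ Γ_B` and the quotient clause for `(A, Ker)` of 1-properness,
  in ANY category; the connected-quasi-temperoid hypothesis is not needed).

Nothing here bears on [IUTchIII] Cor. 3.12; typed ≠ discharged elsewhere.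
-/

open CategoryTheory CategoryTheory.Limits

namespace Literature.AnabelianGeometry.SemiGraphs

namespace QDPair

universe v₁ u u₁

/-- **Definition A.3 (iv), bracket, DISCHARGED** (SemiAnbd Appendix p. 82): for a 1-proper
morphism of QD-pairs `f : (A, Γ_A) → (B, Γ_B)` and a quotient `ψ : B → C ≅ B/Γ_B`, the composite
`A → B → C` forms a quotient `A/Γ_A`. Formal: a `Γ_A`-invariant arrow `χ : A → C'` is invariant
under `Ker(Γ_A ↠ Γ_B)`, hence factors uniquely through `B` (quotient clause of 1-properness); the
factorisation is `Γ_B`-invariant because every `γ_B` lifts to some `γ_A` (surjectivity clause) and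
the factorisation through `B` is unique; then it factors uniquely through `C`.
[cite: MochizukiSemiAnbd2006, Def A.3(iv) p.82] -/
theorem oneProperCompQuotient_holds : OneProperCompQuotient.{v₁, u, u₁} := by
  intro Q _ _ P₁ P₂ f hf C ψ hψ
  obtain ⟨-, hsurj, hquot⟩ := hf
  refine ⟨fun γ hγ => ?_, fun C' χ hχ => ?_⟩
  · obtain ⟨γ', hγ', hcomm⟩ := f.comm γ hγ
    rw [← Category.assoc, ← hcomm, Category.assoc, hψ.1 γ' hγ']
  · -- `χ` is invariant under the stabiliser `Ker(Γ_A ↠ Γ_B) ⊆ Γ_A`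
    have hχstab : ∀ γ ∈ (⟨P₁.A, f.stabilizer⟩ : QDPair Q).Γ, γ.hom ≫ χ = χ :=
      fun γ hγ => hχ γ hγ.1
    obtain ⟨χ₁, hχ₁, hχ₁u⟩ := hquot.2 χ hχstab
    -- the factorisation through `B` is `Γ_B`-invariant
    have hχ₁inv : ∀ γ' ∈ P₂.Γ, γ'.hom ≫ χ₁ = χ₁ := by
      intro γ' hγ'
      obtain ⟨γ, hγ, hc⟩ := hsurj γ' hγ'
      refine hχ₁u _ ?_
      change f.hom ≫ γ'.hom ≫ χ₁ = χ
      rw [← Category.assoc, hc, Category.assoc, hχ₁, hχ γ hγ]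
    obtain ⟨χ₂, hχ₂, hχ₂u⟩ := hψ.2 χ₁ hχ₁inv
    refine ⟨χ₂, ?_, fun χ₂' h' => ?_⟩
    · change (f.hom ≫ ψ) ≫ χ₂ = χ
      rw [Category.assoc, hχ₂, hχ₁]
    · refine hχ₂u _ (hχ₁u _ ?_)
      change f.hom ≫ ψ ≫ χ₂' = χ
      rw [← Category.assoc]
      exact h'

end QDPair

end Literature.AnabelianGeometry.SemiGraphs
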